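import Mathlib.Topology.Algebra.Polynomial
import Literature.NumberTheory.Transcendental.KZCalculus

/-!
# `NormalFormPrinciple` (stmt-KontsevichZagierPeriods-3869), line `SketchIdeator1` —
# the Newton–Leibniz move over the point lies in the sub-calculus of rules (1a) + (3)

Pure proof file (`--supports` the crux stmt-KontsevichZagierPeriods-3869; siege k18, variation
"explicit / elementary"). The registered sub-goal `slab_sub_pt_mem_relations` of the leaf
`stub_boxRigidity` (Newton–Leibniz over the point for a `ℚ`-rational primitive,
`[(α,β), F'] ≡ [pt, F(β) − F(α)]` modulo `KZ.relations`) is already in the tree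
(`…PiBox.Dlog.slab_sub_pt_mem_relations`, file `…SplitMoves.lean`). This file proves the SHARPER,
sub-calculus form of the same move, which is new:

  under the hypotheses of that theorem, `[N] − [Z]` lies in
  `AddSubgroup.closure (domainAddRel ∪ newtonLeibnizRel)` — the subgroup generated by the
  domain-additivity instances (rule 1a) and the Newton–Leibniz instances (rule 3) ALONE; no change
  of variables (rule 2) and no integrand additivity (rule 1b) is used
  (`slab_sub_pt_mem_closure_domainAdd_newtonLeibniz`).

Since that closure is `≤ relations` (`closure_domainAdd_newtonLeibniz_le_relations`), the
`relations` form is an immediate corollary (not restated here); the closure is also contained in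
(in fact equal to, by `integrandAddRel_subset_closure_domAdd_nl` of
`Theorems/StuffleInKZ/Negative/IntegrandAdditivityDerived.lean`) the change-of-variables-free
sub-calculus `covFreeRelations` of `Theorems/StuffleInKZ/Negative/AlgebraicShadow.lean`, which is
not imported here to keep the file on `KZCalculus` alone. The sub-calculus form is the one
relevant to the load-bearing analysis of the calculus for this crux (which printed rules a proof
must use, cf. the crux's `Disproof.lean` §4: the principle is false without rule 3 and false
without the additivity rules).

The proof is EXACTLY two moves, written out with all their data, plus one self-additivity:

* move (3) over the base `ℝ⁰` applied to the CLOSED slab representation `R = [[α,β], f(x₀)]`,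
  base `Z = [pt, F(β) − F(α)]`, band functions the constants `α ≤ β`, primitive
  `z ↦ P_F(z₀)/Q_F(z₀)`: `[R] − [Z] ∈ newtonLeibnizRel`;
* move (1a) applied to `R = N ∪ E`, `E = [{α,β}, f(x₀)]` the endpoint representation (disjoint
  from `N`): `[R] − [N] − [E] ∈ domainAddRel` — applied to `N` itself, no restriction /
  congruence detour;
* move (1a) applied to `E = E ∪ E` (overlap `E`, null): `[E] − [E] − [E] ∈ domainAddRel`, so
  `[E]` lies in the closure;
* `[N] − [Z] = ([R] − [Z]) − ([R] − [N] − [E]) − [E]`.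

Sources: M. Kontsevich, D. Zagier, *Periods* (2001), §1.2, rules (1) and (3). Imports
`KZCalculus` and `Mathlib.Topology.Algebra.Polynomial` only; no definitions are introduced.
-/

noncomputable section

open MeasureTheory Set
open scoped Polynomial
open Literature.NumberTheory.Transcendental Literature.NumberTheory.Transcendental.KZ
open Literature.ModelTheory.ExponentialFields (IsSemialgebraic isSemialgebraic_univ
  isSemialgebraic_setOf_eval_le)

namespace Summit.KontsevichZagierPeriods.HurwitzMicroSectors.NormalFormPrinciple.PiBox

namespace SlabK18

/-- The sub-calculus generated by domain additivity (rule 1a) and Newton–Leibniz (rule 3) is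
part of the full calculus: `closure (domainAddRel ∪ newtonLeibnizRel) ≤ relations`.
[cite: KontsevichZagier2001, §1.2] -/
theorem closure_domainAdd_newtonLeibniz_le_relations :
    AddSubgroup.closure (domainAddRel ∪ newtonLeibnizRel) ≤ relations := by
  refine (AddSubgroup.closure_le _).mpr ?_
  rintro c (hc | hc)
  · exact domainAddRel_subset_relations hc
  · exact newtonLeibnizRel_subset_relations hc

/-- **Newton–Leibniz over the point, inside the sub-calculus of rules (1a) + (3).** Let `α ≤ β`
be rational, `N = [(α,β), f]` an interval representation whose integrand `x ↦ f(x₀)` is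
`ℚ`-semialgebraic on the closed slab, and `F = P_F/Q_F` (`P_F, Q_F ∈ ℚ[X]`, `Q_F ≠ 0` on
`[α,β]`) a primitive of `f` on `(α,β)`. Then for every point representation
`Z = [pt, F(β) − F(α)]`, the difference `[N] − [Z]` lies in the subgroup of `FormalRep` generated
by the domain-additivity and the Newton–Leibniz instances alone:
`[N] − [Z] = ([R] − [Z]) − ([R] − [N] − [E]) − [E]` with `R` the closed-slab representation and
`E` the (null) endpoint representation — ONE move (3), ONE move (1a), and `[E] = −([E] − [E] − [E])`
a move (1a). No change of variables and no integrand additivity is used; the `KZ.relations` form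
(`…PiBox.Dlog.slab_sub_pt_mem_relations`) follows by
`closure_domainAdd_newtonLeibniz_le_relations`. [cite: KontsevichZagier2001, §1.2 rule (3)] -/
theorem slab_sub_pt_mem_closure_domainAdd_newtonLeibniz {α β : ℚ} (hαβ : α ≤ β) (f : ℝ → ℝ)
    (PF QF : ℚ[X])
    (hQF : ∀ t ∈ Set.Icc (α:ℝ) β, (Polynomial.aeval t QF : ℝ) ≠ 0)
    (hderiv : ∀ t ∈ Set.Ioo (α:ℝ) β,
      HasDerivAt (fun u : ℝ => (Polynomial.aeval u PF : ℝ) / Polynomial.aeval u QF) (f t) t)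
    (hf : IsSemialgebraicFunOn ℚ {x : Fin 1 → ℝ | x 0 ∈ Set.Icc (α:ℝ) β} (fun x => f (x 0)))
    (N : IntegralRep 1) (hNd : N.domain = {x | x 0 ∈ Set.Ioo (α:ℝ) β})
    (hNi : EqOn N.integrand (fun x => f (x 0)) N.domain)
    (Z : IntegralRep 0) (hZd : Z.domain = univ)
    (hZi : Z.integrand = fun _ => (Polynomial.aeval (β:ℝ) PF : ℝ) / Polynomial.aeval (β:ℝ) QF -
      (Polynomial.aeval (α:ℝ) PF : ℝ) / Polynomial.aeval (α:ℝ) QF) :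
    of N - of Z ∈ AddSubgroup.closure (domainAddRel ∪ newtonLeibnizRel) := by
  -- the closed slab `C = {α ≤ x₀ ≤ β}` and the open slab `U = {α < x₀ < β} = N.domain`
  set C : Set (Fin 1 → ℝ) := {x | x 0 ∈ Set.Icc (α:ℝ) β} with hC
  set U : Set (Fin 1 → ℝ) := {x | x 0 ∈ Set.Ioo (α:ℝ) β} with hU
  have hαβ' : (α:ℝ) ≤ β := by exact_mod_cast hαβ
  have hUC : U ⊆ C := fun x hx => Set.Ioo_subset_Icc_self hx
  -- (a) `C` is `ℚ`-semialgebraic: `{α ≤ x₀} ∩ {x₀ ≤ β}`; `U` is `N.domain`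
  have hCsa : IsSemialgebraic ℚ C := by
    have h1 := isSemialgebraic_setOf_eval_le (k := ℚ) (R := ℝ)
      (MvPolynomial.C α : MvPolynomial (Fin 1) ℚ) (MvPolynomial.X 0)
    have h2 := isSemialgebraic_setOf_eval_le (k := ℚ) (R := ℝ)
      (MvPolynomial.X 0 : MvPolynomial (Fin 1) ℚ) (MvPolynomial.C β)
    simp only [MvPolynomial.aeval_X, MvPolynomial.aeval_C, eq_ratCast] at h1 h2
    have hCeq : C = {x : Fin 1 → ℝ | (α:ℝ) ≤ x 0} ∩ {x | x 0 ≤ (β:ℝ)} := by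
      ext x
      simp only [hC, Set.mem_setOf_eq, Set.mem_Icc, Set.mem_inter_iff]
    rw [hCeq]
    exact h1.inter h2
  have hUsa : IsSemialgebraic ℚ U := hNd ▸ N.isSemialgebraic_domain
  -- (b) the endpoint set `C \ U ⊆ {x₀ = α} ∪ {x₀ = β}` is Lebesgue-null
  have hEvol : volume (C \ U) = 0 := by
    have hα : volume {w : Fin 1 → ℝ | w 0 = α} = 0 := by
      rw [volume_pi]; exact Measure.pi_hyperplane _ _ _
    have hβ : volume {w : Fin 1 → ℝ | w 0 = β} = 0 := by
      rw [volume_pi]; exact Measure.pi_hyperplane _ _ _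
    refine measure_mono_null (fun x hx => ?_) (measure_union_null hα hβ)
    obtain ⟨⟨h1, h2⟩, h3⟩ := hx
    simp only [hU, Set.mem_setOf_eq, Set.mem_Ioo, not_and, not_lt] at h3
    simp only [Set.mem_union, Set.mem_setOf_eq]
    rcases h1.lt_or_eq with h1 | h1
    · exact Or.inr (le_antisymm h2 (h3 h1))
    · exact Or.inl h1.symm
  -- (c) `x ↦ f(x₀)` is integrable on `U` (it is `N.integrand` there), hence on `C = U ∪ (C \ U)`
  have hfU : IntegrableOn (fun x : Fin 1 → ℝ => f (x 0)) U := by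
    have h := N.integrableOn.congr_fun hNi (IntegralRep.measurableSet_domain_holds N)
    rwa [hNd] at h
  have hfC : IntegrableOn (fun x : Fin 1 → ℝ => f (x 0)) C := by
    rw [← Set.union_sdiff_cancel hUC]
    exact hfU.union (IntegrableOn.of_measure_zero hEvol)
  -- the two auxiliary representations: the closed slab `R` and the endpoints `E`, integrand `f(x₀)`
  obtain ⟨R, hRd, hRi⟩ : ∃ R : IntegralRep 1, R.domain = C ∧ R.integrand = fun x => f (x 0) :=
    ⟨⟨C, fun x => f (x 0), hCsa, hf, hfC⟩, rfl, rfl⟩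
  obtain ⟨E, hEd, hEi⟩ : ∃ E : IntegralRep 1, E.domain = C \ U ∧ E.integrand = fun x => f (x 0) :=
    ⟨⟨C \ U, fun x => f (x 0), hCsa.diff hUsa, hf.mono Set.sdiff_subset (hCsa.diff hUsa),
      IntegrableOn.of_measure_zero hEvol⟩, rfl, rfl⟩
  have hs0 : ∀ (x : Fin 0 → ℝ) (t : ℝ), (Fin.snoc x t : Fin 1 → ℝ) 0 = t := fun _ _ => rfl
  -- polynomials in `x₀` as polynomials on `ℝ¹`
  have hX : ∀ (x : Fin 1 → ℝ) (A : ℚ[X]), MvPolynomial.aeval x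
      (Polynomial.aeval (MvPolynomial.X 0 : MvPolynomial (Fin 1) ℚ) A) =
        (Polynomial.aeval (x 0) A : ℝ) := by
    intro x A
    rw [← Polynomial.aeval_algHom_apply, MvPolynomial.aeval_X]
  -- MOVE (3): `[R] − [Z] ∈ newtonLeibnizRel`, base `ℝ⁰`, band `[α, β]`, primitive `P_F(z₀)/Q_F(z₀)`
  have hNL : of R - of Z ∈ newtonLeibnizRel := by
    refine ⟨0, R, Z, fun _ => (α:ℝ), fun _ => (β:ℝ),
      fun z => (Polynomial.aeval (z 0) PF : ℝ) / Polynomial.aeval (z 0) QF,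
      ?_, ?_, ?_, fun _ _ => hαβ', ?_, ?_, ?_, ?_, rfl⟩
    · -- the primitive is a quotient of polynomials over `ℚ`, denominator `≠ 0` on `C`
      rw [hRd]
      refine (isSemialgebraicFunOn_aeval_div_aeval hCsa
        (Polynomial.aeval (MvPolynomial.X 0 : MvPolynomial (Fin 1) ℚ) PF)
        (Polynomial.aeval (MvPolynomial.X 0 : MvPolynomial (Fin 1) ℚ) QF) fun x hx => ?_).congr
        fun x _ => ?_
      · rw [hX]; exact hQF (x 0) hx
      · simp only [hX]
    · -- the lower band function: the constant `α`
      rw [hZd]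
      simpa using isSemialgebraicFunOn_aeval (isSemialgebraic_univ (k := ℚ) (ι := Fin 0) (R := ℝ))
        (MvPolynomial.C α)
    · -- the upper band function: the constant `β`
      rw [hZd]
      simpa using isSemialgebraicFunOn_aeval (isSemialgebraic_univ (k := ℚ) (ι := Fin 0) (R := ℝ))
        (MvPolynomial.C β)
    · -- the band over `ℝ⁰` with ends `α ≤ β` is the closed slab
      rw [hRd, hZd, hC]
      ext z
      simp only [Set.mem_setOf_eq, Set.mem_Icc, Set.mem_univ, true_and]
      rfl
    · -- continuity of the primitive on the closed fibre
      intro x _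
      simp only [hs0]
      exact ((Polynomial.continuous_aeval PF).continuousOn).div
        (Polynomial.continuous_aeval QF).continuousOn hQF
    · -- its derivative on the open fibre is the integrand
      intro x _ t ht
      rw [hRi]
      simp only [hs0]
      exact hderiv t ht
    · -- the base integrand is `F(β) − F(α)`
      intro x _
      rw [hZi]
      simp only [hs0]
  -- MOVE (1a): `[R] − [N] − [E] ∈ domainAddRel` (`C = U ∪ (C \ U)`, empty overlap)
  have hDA : of R - of N - of E ∈ domainAddRel := by
    refine ⟨1, R, N, E, ?_, ?_, ?_, ?_, rfl⟩
    · rw [hRd, hNd, hEd]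
      exact (Set.union_sdiff_cancel hUC).symm
    · rw [hNd, hEd, Set.inter_sdiff_self]
      exact measure_empty
    · intro x hx
      rw [hRi, hNi hx]
    · intro x _
      rw [hRi, hEi]
  -- MOVE (1a) once more: `[E] − [E] − [E] ∈ domainAddRel` (`E = E ∪ E`, overlap `E` null)
  have hEE : of E - of E - of E ∈ domainAddRel :=
    ⟨1, E, E, E, (Set.union_self _).symm, by rw [Set.inter_self, hEd]; exact hEvol,
      fun _ _ => rfl, fun _ _ => rfl, rfl⟩
  -- assemble inside the closure `S` of the (1a)- and (3)-instances
  set S : AddSubgroup FormalRep := AddSubgroup.closure (domainAddRel ∪ newtonLeibnizRel)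
  have hDAS : domainAddRel ⊆ S := fun _ hc => AddSubgroup.subset_closure (Or.inl hc)
  have hNLS : newtonLeibnizRel ⊆ S := fun _ hc => AddSubgroup.subset_closure (Or.inr hc)
  have hE : of E ∈ S := by
    have h := hDAS hEE
    rw [sub_self, zero_sub] at h
    exact neg_mem_iff.mp h
  have : of N - of Z = (of R - of Z) - (of R - of N - of E) - of E := by abel
  rw [this]
  exact S.sub_mem (S.sub_mem (hNLS hNL) (hDAS hDA)) hE

end SlabK18

end Summit.KontsevichZagierPeriods.HurwitzMicroSectors.NormalFormPrinciple.PiBox
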